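import Summits.BirchSwinnertonDyer.BirchSwinnertonDyer.Theorems.AlignedTransportAtTwoMainConjectureOfRankZeroBSDAtTwoFineRoadKleinExtensionS3
import Summits.BirchSwinnertonDyer.BirchSwinnertonDyer.Theorems.AlignedTransportAtTwoMainConjectureOfRankZeroBSDAtTwoFineRoadPerfectDescent
import Literature.NumberTheory.EllipticCurves.H1CorestrictionIndexTwo
import Literature.NumberTheory.EllipticCurves.PeriodIndexCorestrictionLocal
import Literature.NumberTheory.EllipticCurves.IwasawaSelmerProofs
import HarnessLib

/-!
# Route `AlignedTransportAtTwo`, crux C2 `MainConjectureOfRankZeroBSDAtTwo` (stmt-BirchSwinnertonDyer-22298),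
# road (b″): PERFECT DESCENT at `2`, part V — `res : H¹(H, E[2]) → H¹(H ⊓ Gal(K̄/K(E[2])), E[2])^{H}` is ONTO;
# with part II: `H¹(H, E[2]) ≅ Hom_H(Gal(K̄/L(E[2])), E[2])` for EVERY `H = Gal(K̄/L) ≤ Γ_K`

Cell `bsd-f1-sign2`, WIDTH-5 attach seat `bsd-line-att-p3` (gen 4) on line `birth` of crux C2
(`--supports` stmt-BirchSwinnertonDyer-22298; closes nothing). HONEST FRAMING: THEOREMS ONLY — no definition, no
named fact, no instance, no `sorry`; BSD is NOT proved by any of this. Kernel form of §3 (ii) of the lead's note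
`Cruxes/MainConjectureOfRankZeroBSDAtTwo/PERFECT-DESCENT.md` (att-p2 g4): «inflation–restriction for `F_∞/ℚ_∞` with
`E[2]`-coefficients has BOTH outer terms `0`, so `H¹(ℚ_Σ/ℚ_∞, E[2]) = Hom_{G_∞}(Gal(ℚ̄/F_∞), E[2])` on the nose».
Part II gave injectivity (`H¹(Q̄, V₄) = 0`); parts III–IV gave `H²(Q̄, V₄) = 0` as the algebraic extension theorem
`PerfectDescent.exists_crossedHom_extension`; this file adds the topology (continuity is AUTOMATIC: the kernel of
the action is open) and the Galois specialisations.

## What is proved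

* §1 (tree model; topological group `G`, discrete `G`-module `M` with `#M = 4`, `m + m = 0`, subgroups `H₁ ≤ H₂`
  with `H₁ = {g ∈ H₂ | g acts trivially}` and `H₁` OPEN in `H₂`) **`exists_resOfLe_eq_of_klein`**: every
  continuous cocycle `z` on `H₁` (= continuous homomorphism, `H₁` acts trivially) which is `H₂`-EQUIVARIANT
  (`z (g x g⁻¹) = g • z x`) is the restriction of a class of `H¹(H₂, M)`: the algebraic extension `A` of
  `exists_crossedHom_extension` is locally constant (`A (g k) = A g + g • z k` on the open coset `g H₁`).
  **`exists_resOfLe_eq_of_forall_conjH1_eq_of_klein`**: the same with the invariance stated through the tree's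
  `conjH1` (for `H₁` normal in `G`); **`mem_range_resOfLe_iff_of_klein`**: with part II, `res` is a BIJECTION of
  `H¹(H₂, M)` onto the `H₂`-invariant classes of `H¹(H₁, M)`.
* §2 (elliptic `W` over a field `K` with `2 ≠ 0`, ANY `H ≤ Γ_K`, `H₁ = H ⊓ ker ρ̄_{E,2}` — open in `H` by the tree's
  `isOpen_ker_galoisRepTorsion_holds`) **`exists_resOfLe_eq_geomTorsion_two`** (cocycle form, every `H`) and
  **`mem_range_resOfLe_geomTorsion_two_iff`** (for `H ⊓ ker ρ̄` normal in `Γ_K`, e.g. `H` normal):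
  `H¹(H, E[2]) ≅ H¹(H ⊓ ker ρ̄, E[2])^{H}` = the `H`-equivariant continuous homomorphisms `Gal(K̄/L(E[2])) → E[2]`.
* §3 (number field `K`, any `ℤ_p`-extension `κ`, `K_∞ = K̄^{ker κ}`, `F_∞ = K_∞(E[2])`)
  **`mem_range_resOfLe_kerSubgroup_geomTorsion_two_iff`**: `H¹(K_∞, E[2]) ≅ H¹(F_∞, E[2])^{Gal(F_∞/K_∞)}` — for
  `K = ℚ`, `p = 2` and an `S₃`-curve this is PERFECT-DESCENT.md §3 (ii) (`G_∞ ≅ S₃`, or `C₃`).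

Not here: the class-field-theoretic identification of `Hom(Gal(K̄/F_∞)^{ab}, E[2])` with `X(F_∞)`, the local
conditions, Ferrero–Washington (§3 (iii)–(v) of the note).

References: J.-P. Serre, *Galois Cohomology*, I §2.6 (b); Neukirch–Schmidt–Wingberg (1.6.7); R. Greenberg,
LNM 1716 (1999) §3; J. H. Silverman, *AEC* III.7, X.4.
-/

set_option autoImplicit false
-- the Theorems namespace of this sub repeats the summit name by design (D-0017 nested layout)
set_option linter.dupNamespace false

noncomputable section

open scoped Classical Pointwise

namespace Summit.BirchSwinnertonDyer.BirchSwinnertonDyer.Theorems.AlignedTransportAtTwoFineRoad.PerfectDescent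

open Literature.NumberTheory.EllipticCurves Literature.NumberTheory.GaloisRepresentations Topology

universe u

/-! ## §1 The tree's model: `res : H¹(H₂, M) → H¹(H₁, M)^{H₂}` is onto when `H₁ = ker(H₂ → Aut M)` is open -/

section Generic

variable {G : Type u} [Group G] [TopologicalSpace G] [IsTopologicalGroup G]
  {M : Type u} [AddCommGroup M] [DistribMulAction G M] [TopologicalSpace M] [DiscreteTopology M]

/-- **Inflation–restriction with Klein coefficients, SURJECTIVE form.** Let `H₁ ≤ H₂ ≤ G` with
`H₁ = {g ∈ H₂ | g acts trivially on M}` OPEN in `H₂`, `M` a discrete `G`-module with four elements and `m + m = 0`.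
Then every continuous cocycle `z` on `H₁` (a continuous homomorphism, as `H₁` acts trivially) which is
`H₂`-equivariant — `z y = g • z x` whenever `y = g x g⁻¹`, `g ∈ H₂` — is the restriction of a class of `H¹(H₂, M)`:
the transgression of `[z]` lies in `H²(H₂/H₁, M) = 0` (`exists_crossedHom_extension`), and the algebraic extension
is automatically continuous. [cite: SerreGaloisCohomology1997, I §2.6 (b)] [cite: NeukirchSchmidtWingberg2008, I.§6 Prop. 1.6.7] -/
theorem exists_resOfLe_eq_of_klein {H₁ H₂ : Subgroup G} (hle : H₁ ≤ H₂) (h4 : Nat.card M = 4)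
    (h2 : ∀ m : M, m + m = 0) (hH₁ : ∀ g ∈ H₂, (g ∈ H₁ ↔ ∀ m : M, g • m = m))
    (hopen : IsOpen ((H₁.subgroupOf H₂ : Subgroup H₂) : Set H₂)) (z : contOneCocycles (discreteTopRep H₁ M))
    (hinv : ∀ g ∈ H₂, ∀ x y : H₁, (y : G) = g * x * g⁻¹ → z.1 y = g • z.1 x) :
    ∃ c' : subgroupH1 H₂ M, resOfLe M hle c' = oneCocycleClass _ z := by
  -- the kernel of the action of `H₂`, as a subgroup of `H₂`
  set N : Subgroup H₂ := H₁.subgroupOf H₂ with hNdef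
  have hN : ∀ g : H₂, g ∈ N ↔ ∀ m : M, g • m = m := fun g ↦ by
    rw [hNdef, Subgroup.mem_subgroupOf]
    exact hH₁ g g.2
  -- `z` as a total function on `H₂`
  set φ : H₂ → M := fun g ↦ if h : (g : G) ∈ H₁ then z.1 ⟨g, h⟩ else 0 with hφdef
  have hφN : ∀ (g : H₂) (hg : (g : G) ∈ H₁), φ g = z.1 ⟨g, hg⟩ := fun g hg ↦ dif_pos hg
  have hφ : ∀ x ∈ N, ∀ y ∈ N, φ (x * y) = φ x + φ y := by
    intro x hx y hy
    have hx' : (x : G) ∈ H₁ := Subgroup.mem_subgroupOf.mp hx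
    have hy' : (y : G) ∈ H₁ := Subgroup.mem_subgroupOf.mp hy
    have hxy : ((x * y : H₂) : G) ∈ H₁ := H₁.mul_mem hx' hy'
    rw [hφN _ hxy, hφN x hx', hφN y hy']
    have e : (⟨((x * y : H₂) : G), hxy⟩ : H₁) = ⟨x, hx'⟩ * ⟨y, hy'⟩ := Subtype.ext rfl
    rw [e, cocycle_mul H₁ z]
    change z.1 ⟨x, hx'⟩ + (x : G) • z.1 ⟨y, hy'⟩ = _
    rw [((hH₁ x x.2).mp hx') (z.1 ⟨y, hy'⟩)]
  have hφeq : ∀ (g : H₂), ∀ x ∈ N, φ (g * x * g⁻¹) = g • φ x := by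
    intro g x hx
    have hx' : (x : G) ∈ H₁ := Subgroup.mem_subgroupOf.mp hx
    have hc : ((g * x * g⁻¹ : H₂) : G) ∈ H₁ := by
      refine (hH₁ _ (g * x * g⁻¹).2).mpr fun m ↦ ?_
      rw [Subgroup.coe_mul, Subgroup.coe_mul, Subgroup.coe_inv]
      exact conj_smul_eq_self_of_smul_eq_self ((hH₁ x x.2).mp hx') (g : G) m
    rw [hφN _ hc, hφN x hx', Subgroup.smul_def]
    exact hinv g g.2 ⟨x, hx'⟩ ⟨_, hc⟩ rfl
  -- the algebraic extension (`H² = 0`)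
  obtain ⟨A, hA2, hAN⟩ := exists_crossedHom_extension (Q := H₂) h4 h2 N hN φ hφ hφeq
  have hA1 : ∀ (k : H₂) (hk : (k : G) ∈ H₁), A k = z.1 ⟨k, hk⟩ := fun k hk ↦ by
    rw [hAN k (Subgroup.mem_subgroupOf.mpr hk), hφN k hk]
  -- continuity: `A` is locally constant (`H₁` open in `H₂`, `z` continuous, `A (g k) = A g + g • z k`)
  have hAcont : Continuous A := by
    refine IsLocallyConstant.continuous ((IsLocallyConstant.iff_exists_open A).2 fun g₀ ↦ ?_)
    let ι : ↥N → H₁ := fun s ↦ ⟨((s : H₂) : G), Subgroup.mem_subgroupOf.1 s.2⟩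
    have hι : Continuous ι := (continuous_subtype_val.comp continuous_subtype_val).subtype_mk _
    let ζ : ↥N → M := fun s ↦ z.1 (ι s)
    have hζ : Continuous ζ := z.1.continuous.comp hι
    set T : Set ↥N := ζ ⁻¹' {0} with hT
    have hTopen : IsOpen T := (isOpen_discrete ({0} : Set M)).preimage hζ
    set V : Set H₂ := Subtype.val '' T with hV
    have hVopen : IsOpen V := hopen.isOpenMap_subtype_val _ hTopen
    have h1V : (1 : H₂) ∈ V := by
      refine ⟨⟨1, one_mem _⟩, ?_, rfl⟩
      change z.1 ⟨((1 : H₂) : G), _⟩ = 0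
      have e : (⟨((1 : H₂) : G), Subgroup.mem_subgroupOf.1 (one_mem (H₁.subgroupOf H₂))⟩ : H₁) = 1 :=
        Subtype.ext rfl
      rw [e]
      exact cocycle_one H₁ z
    refine ⟨(g₀ * ·) '' V, isOpenMap_mul_left g₀ _ hVopen, ⟨1, h1V, mul_one g₀⟩, ?_⟩
    rintro _ ⟨k, ⟨s, hs, rfl⟩, rfl⟩
    have hk : ((s : H₂) : G) ∈ H₁ := Subgroup.mem_subgroupOf.1 s.2
    have hzs : z.1 ⟨((s : H₂) : G), hk⟩ = 0 := hs
    rw [hA2, hA1 _ hk, hzs, smul_zero, add_zero]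
  -- the extended cocycle
  let zt : contOneCocycles (discreteTopRep H₂ M) :=
    ⟨⟨A, hAcont⟩, fun g h ↦ by
      change A (g * h) = A g + (discreteTopRep H₂ M).ρ g (A h)
      rw [hA2, discreteTopRep_ρ_apply]⟩
  refine ⟨oneCocycleClass _ zt, ?_⟩
  rw [resOfLe, resH1Hom_oneCocycleClass]
  congr 1
  apply Subtype.ext
  ext x
  rw [pullback_resHomOfEquivariant_apply, AddMonoidHom.id_apply]
  change A (Subgroup.inclusion hle x) = z.1 x
  rw [hA1 (Subgroup.inclusion hle x) x.2]
  exact congrArg z.1 (Subtype.ext rfl)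

/-- **The same, with the invariance stated through the tree's conjugation action `conjH1`** (`H₁` normal in `G`):
every class `c ∈ H¹(H₁, M)` with `conj_g c = c` for all `g ∈ H₂` is a restriction from `H¹(H₂, M)`. (On cocycles
`conj_g [z] = [z]` reads `g • z(g⁻¹ x g) - z(x) = x • a - a = 0`, as `x ∈ H₁` acts trivially.)
[cite: SerreGaloisCohomology1997, I §2.6 (b)] [cite: NeukirchSchmidtWingberg2008, I.§6 Prop. 1.6.7] -/
theorem exists_resOfLe_eq_of_forall_conjH1_eq_of_klein {H₁ H₂ : Subgroup G} [H₁.Normal] (hle : H₁ ≤ H₂)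
    (h4 : Nat.card M = 4) (h2 : ∀ m : M, m + m = 0) (hH₁ : ∀ g ∈ H₂, (g ∈ H₁ ↔ ∀ m : M, g • m = m))
    (hopen : IsOpen ((H₁.subgroupOf H₂ : Subgroup H₂) : Set H₂)) (c : subgroupH1 H₁ M)
    (hinv : ∀ g ∈ H₂, conjH1 H₁ M g c = c) :
    ∃ c' : subgroupH1 H₂ M, resOfLe M hle c' = c := by
  obtain ⟨z, rfl⟩ := oneCocycleClass_surjective (discreteTopRep H₁ M) c
  refine exists_resOfLe_eq_of_klein hle h4 h2 hH₁ hopen z fun g hg x y hy ↦ ?_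
  -- invariance under `g⁻¹ ∈ H₂` on cocycles
  have h := hinv g⁻¹ (H₂.inv_mem hg)
  rw [conjH1_oneCocycleClass, ← sub_eq_zero, ← oneCocycleClass_sub, oneCocycleClass_eq_zero_iff] at h
  obtain ⟨a, ha⟩ := h
  have hx := ha x
  rw [sub_apply_val, conjCocycle_apply, discreteTopRep_ρ_apply, Subgroup.smul_def] at hx
  -- `x` acts trivially, so the boundary term vanishes
  rw [((hH₁ x (hle x.2)).mp x.2) a, sub_self, sub_eq_zero] at hx
  have e : subgroupConj H₁ g⁻¹ x = y := Subtype.ext (by rw [subgroupConj_apply_coe, inv_inv, hy])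
  rw [e] at hx
  -- `hx : g⁻¹ • z y = z x`
  have hx' := congrArg (fun m ↦ g • m) hx
  simp only [smul_inv_smul] at hx'
  exact hx'

/-- **`res : H¹(H₂, M) ≅ H¹(H₁, M)^{H₂}`** (with part II): for `H₁ ≤ H₂` normal subgroups of `G` with `H₁` the OPEN
kernel of the action of `H₂` on the Klein four-group `M`, a class of `H¹(H₁, M)` is a restriction from `H¹(H₂, M)`
iff it is fixed by `conj_g` for every `g ∈ H₂`; and the restriction is injective (`resOfLe_injective_of_klein`).
[cite: SerreGaloisCohomology1997, I §2.6 (b)] -/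
theorem mem_range_resOfLe_iff_of_klein {H₁ H₂ : Subgroup G} [H₁.Normal] [H₂.Normal] (hle : H₁ ≤ H₂)
    (h4 : Nat.card M = 4) (h2 : ∀ m : M, m + m = 0) (hH₁ : ∀ g ∈ H₂, (g ∈ H₁ ↔ ∀ m : M, g • m = m))
    (hopen : IsOpen ((H₁.subgroupOf H₂ : Subgroup H₂) : Set H₂)) (c : subgroupH1 H₁ M) :
    c ∈ Set.range (resOfLe M hle) ↔ ∀ g ∈ H₂, conjH1 H₁ M g c = c := by
  constructor
  · rintro ⟨c', rfl⟩ g hg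
    exact conjH1_resOfLe_of_mem (M := M) hle hg c'
  · intro h
    obtain ⟨c', hc'⟩ := exists_resOfLe_eq_of_forall_conjH1_eq_of_klein hle h4 h2 hH₁ hopen c h
    exact ⟨c', hc'⟩

end Generic

/-! ## §2 Elliptic curves: `H¹(H, E[2]) ≅ H¹(H ⊓ Gal(K̄/K(E[2])), E[2])^{H}` for every `H ≤ Γ_K` -/

section TwoTorsion

open WeierstrassCurve

variable {K : Type} [Field K] (W : WeierstrassCurve K) [W.IsElliptic]

omit [W.IsElliptic] in
/-- An element of `ker ρ̄_{E,2}` fixes `E[2]` pointwise. [folklore] -/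
theorem smul_eq_self_of_mem_ker_galoisRepTorsion_two {g : Field.absoluteGaloisGroup K}
    (hg : g ∈ (W.galoisRepTorsion 2).ker) (P : W.geomTorsion 2) : g • P = P := by
  rw [MonoidHom.mem_ker] at hg
  rw [← galoisRepTorsion_apply, hg]
  rfl

omit [W.IsElliptic] in
/-- `H ⊓ ker ρ̄_{E,2}` is exactly the set of elements of `H` acting trivially on `E[2]`. [folklore] -/
theorem mem_inf_ker_galoisRepTorsion_two_iff (H : Subgroup (Field.absoluteGaloisGroup K))
    {g : Field.absoluteGaloisGroup K} (hg : g ∈ H) :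
    g ∈ H ⊓ (W.galoisRepTorsion 2).ker ↔ ∀ P : W.geomTorsion 2, g • P = P :=
  ⟨fun h ↦ smul_eq_self_of_mem_ker_galoisRepTorsion_two W h.2,
    fun h ↦ ⟨hg, mem_ker_galoisRepTorsion_two_of_forall_smul_eq W h⟩⟩

/-- `H ⊓ ker ρ̄_{E,2}` is OPEN in `H` (`ker ρ̄` is open: the tree's `isOpen_ker_galoisRepTorsion_holds`).
[cite: SilvermanAEC2009, III.§7] -/
theorem isOpen_subgroupOf_inf_ker_galoisRepTorsion_two (H : Subgroup (Field.absoluteGaloisGroup K)) :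
    IsOpen (((H ⊓ (W.galoisRepTorsion 2).ker).subgroupOf H : Subgroup H) : Set H) := by
  have hopen : IsOpen (((W.galoisRepTorsion 2).ker : Set (Field.absoluteGaloisGroup K))) :=
    W.isOpen_ker_galoisRepTorsion_holds (n := 2) two_ne_zero
  have e : (((H ⊓ (W.galoisRepTorsion 2).ker).subgroupOf H : Subgroup H) : Set H) =
      Subtype.val ⁻¹' ((W.galoisRepTorsion 2).ker : Set (Field.absoluteGaloisGroup K)) := by
    ext x
    simp only [SetLike.mem_coe, Subgroup.mem_subgroupOf, Subgroup.mem_inf, Set.mem_preimage]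
    exact ⟨fun h ↦ h.2, fun h ↦ ⟨x.2, h⟩⟩
  rw [e]
  exact hopen.preimage continuous_subtype_val

/-- **Perfect descent at `2`, surjective half, for EVERY `H ≤ Γ_K` (cocycle form).** For an elliptic `E = W` over
a field `K` with `2 ≠ 0` and any subgroup `H ≤ Γ_K`: every continuous homomorphism
`z : H ⊓ Gal(K̄/K(E[2])) → E[2]` (a cocycle — the action is trivial there) which is `H`-equivariant
(`z(g x g⁻¹) = g • z(x)`) is the restriction of a class of `H¹(H, E[2])`. With part II the restriction
`H¹(H, E[2]) → H¹(H ⊓ ker ρ̄, E[2])` is a bijection onto the `H`-equivariant homomorphisms: `H¹(Gal(L(E[2])/L), E[2])`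
and the transgression into `H²(Gal(L(E[2])/L), E[2])` both vanish, for every image `Gal(L(E[2])/L) ≤ S₃` — globally
(`H = Gal(K̄/L)`) and locally (`H = Gal(K̄/L) ⊓ D_v`). [cite: SerreGaloisCohomology1997, I §2.6 (b)]
[cite: SilvermanAEC2009, III.§7 and X.4] -/
theorem exists_resOfLe_eq_geomTorsion_two (hK : (2 : K) ≠ 0) (H : Subgroup (Field.absoluteGaloisGroup K))
    (z : contOneCocycles (discreteTopRep ↥(H ⊓ (W.galoisRepTorsion 2).ker) (W.geomTorsion 2)))
    (hinv : ∀ g ∈ H, ∀ x y : ↥(H ⊓ (W.galoisRepTorsion 2).ker),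
      (y : Field.absoluteGaloisGroup K) = g * x * g⁻¹ → z.1 y = g • z.1 x) :
    ∃ c' : subgroupH1 H (W.geomTorsion 2),
      resOfLe (W.geomTorsion 2) (inf_le_left : H ⊓ (W.galoisRepTorsion 2).ker ≤ H) c' =
        oneCocycleClass _ z :=
  exists_resOfLe_eq_of_klein (M := W.geomTorsion 2) inf_le_left (natCard_geomTorsion_two_of_two_ne_zero W hK)
    (fun P ↦ Subtype.ext (by
      have h : (P : W.geomPoints) ∈ W.geomTorsion 2 := P.2
      rw [WeierstrassCurve.mem_geomTorsion_iff, two_zsmul] at h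
      exact h))
    (fun _ hg ↦ mem_inf_ker_galoisRepTorsion_two_iff W H hg) (isOpen_subgroupOf_inf_ker_galoisRepTorsion_two W H)
    z hinv

/-- **`H¹(H, E[2]) ≅ H¹(H ⊓ ker ρ̄_{E,2}, E[2])^{H}`** for `H ≤ Γ_K` with `H` and `H ⊓ ker ρ̄` normal in `Γ_K` (e.g.
`H = Gal(K̄/L)` for `L/K` Galois; then `H ⊓ ker ρ̄ = Gal(K̄/L(E[2]))`): a class of `H¹(H ⊓ ker ρ̄, E[2]) =
Hom_cont(Gal(K̄/L(E[2])), E[2])` is a restriction from `H¹(H, E[2])` iff it is invariant under `conj_g`, `g ∈ H`;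
the restriction is injective by `resOfLe_inf_ker_galoisRepTorsion_two_injective` (part II). PERFECT DESCENT to the
`2`-division field, any image of `ρ̄`. [cite: SerreGaloisCohomology1997, I §2.6 (b)] [cite: SilvermanAEC2009, X.4] -/
theorem mem_range_resOfLe_geomTorsion_two_iff (hK : (2 : K) ≠ 0) (H : Subgroup (Field.absoluteGaloisGroup K))
    [H.Normal] [(H ⊓ (W.galoisRepTorsion 2).ker).Normal]
    (c : subgroupH1 (H ⊓ (W.galoisRepTorsion 2).ker) (W.geomTorsion 2)) :
    c ∈ Set.range (resOfLe (W.geomTorsion 2) (inf_le_left : H ⊓ (W.galoisRepTorsion 2).ker ≤ H)) ↔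
      ∀ g ∈ H, conjH1 (H ⊓ (W.galoisRepTorsion 2).ker) (W.geomTorsion 2) g c = c :=
  mem_range_resOfLe_iff_of_klein (M := W.geomTorsion 2) inf_le_left (natCard_geomTorsion_two_of_two_ne_zero W hK)
    (fun P ↦ Subtype.ext (by
      have h : (P : W.geomPoints) ∈ W.geomTorsion 2 := P.2
      rw [WeierstrassCurve.mem_geomTorsion_iff, two_zsmul] at h
      exact h))
    (fun _ hg ↦ mem_inf_ker_galoisRepTorsion_two_iff W H hg) (isOpen_subgroupOf_inf_ker_galoisRepTorsion_two W H)
    c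

end TwoTorsion

/-! ## §3 The cyclotomic tower: `H¹(K_∞, E[2]) ≅ H¹(K_∞(E[2]), E[2])^{Gal(K_∞(E[2])/K_∞)}` -/

section Tower

open WeierstrassCurve

variable {K : Type} [Field K] [NumberField K] (W : WeierstrassCurve K) [W.IsElliptic] {p : ℕ} [Fact p.Prime]
  (κ : ZpExtension K p)

/-- **Perfect descent along `F_∞ = K_∞(E[2])` over `K_∞ = K̄^{ker κ}`** (any number field `K`, any `ℤ_p`-extension,
any elliptic `E`): a class of `H¹(F_∞, E[2]) = Hom_cont(Gal(K̄/F_∞), E[2])` comes from `H¹(K_∞, E[2])` iff it is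
`Gal(F_∞/K_∞)`-invariant (indeed `ker κ`-invariant), and then from a UNIQUE class
(`resOfLe_kerSubgroup_inf_ker_galoisRepTorsion_two_injective`). For `K = ℚ`, `p = 2`, `E` with `S₃`-image this is
§3 (ii) of PERFECT-DESCENT.md: `H¹(ℚ_∞, E[2]) ≅ Hom_{G_∞}(Gal(ℚ̄/F_∞)^{ab}, E[2])`, `G_∞ = Gal(F_∞/ℚ_∞) ≅ S₃`.
[cite: SerreGaloisCohomology1997, I §2.6 (b)] [cite: GreenbergLNM1716, §3 (restriction maps in the cyclotomic tower)] -/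
theorem mem_range_resOfLe_kerSubgroup_geomTorsion_two_iff
    (c : subgroupH1 (κ.kerSubgroup ⊓ (W.galoisRepTorsion 2).ker) (W.geomTorsion 2)) :
    c ∈ Set.range (resOfLe (W.geomTorsion 2)
        (inf_le_left : κ.kerSubgroup ⊓ (W.galoisRepTorsion 2).ker ≤ κ.kerSubgroup)) ↔
      ∀ g ∈ κ.kerSubgroup, conjH1 (κ.kerSubgroup ⊓ (W.galoisRepTorsion 2).ker) (W.geomTorsion 2) g c = c :=
  mem_range_resOfLe_geomTorsion_two_iff W two_ne_zero κ.kerSubgroup c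

end Tower

end Summit.BirchSwinnertonDyer.BirchSwinnertonDyer.Theorems.AlignedTransportAtTwoFineRoad.PerfectDescent

end
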